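import Literature.MathematicalPhysics.QuantumFieldTheory.Balaban1983to89.B8Lemma1NonAbelian
import HarnessLib

/-!
# T⁴ programme, node NE3 — the kinematic refinement lemma, leaf R2b (part 1): THE CHAIN-END WORD COMBINATORICS
# of Bałaban's block average (42)

NE3 prover lineage P1, gen 17 (cell `pub-balaban`, unit `b2b-balaban-t4-ne3-p1`, row NE3 OWNER); companion of
`Support/ChainEndContraction` (leaf R2a) and `Support/MinimalActionRefine`; skeleton SKELETON-NE3-P1.md v1.1 §3 leaf R2.
[folklore] lattice-word bookkeeping over the tree's `B7Prop1Explicit` carriers.  The CHAIN of the coarse bond `(z, κ)` is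
the straight contour `Γ_c` of (42) from `L·z` (`L` fine bonds in direction `κ`); its CHAIN END is the last of them,
characterised as the fine bond `(y, κ)` with `L ∣ (y + e_κ)_ν` for every `ν` (`IsChainEnd`, §1); `modify L W c`
multiplies every chain end on the right by the coarse field `c` at its coarse bond.  §2: `hol (modify L W c) x w = hol W x w`
for words AVOIDING the chain ends (`Avoids`, with `avoids_append` ∕ `avoids_revWord` ∕ segments).  §3: from a block corner
`L·z`, the tree word `treeWord (boxVec L r)` avoids every chain end (its `μ`-steps sit at in-block positions `≤ L − 2`),
an OFF-LINE line (`r_ν ≠ 0` for some `ν ≠ κ`) avoids them, and the chain meets exactly its own end (`hol_modify_chain`).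
§4: ON-LINE loops of (42) are degenerate for EVERY configuration (`Wcx_online … = 1`); OFF-LINE loops of the modified
configuration are the old ones twisted by `Ad_S(c⁻¹)` (**`Wcx_modify_offline`**, `S = hol W (L·z) (seg κ L)`).  §5: hence
**`Xavg_modify`** ∕ **`bavg_modify`**: `\overline{modify L W c}(c) = exp(Σ_{r off-line} L^{−d} log(Wcx_r · S (c z κ)⁻¹ S⁻¹)) · S · c z κ`
— the average at `(z, κ)` depends on `c` only through `c z κ`, and this is the equation leaf R2a
(`ChainEndContraction.exists_chainEnd_fixedPoint`) solves, one coarse bond at a time.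

HONEST FRAMING.  Pure bookkeeping about words and the definition (42); nothing here is an estimate; no conditional of
the cell (`BetaPertH`, (B), (B^μ)) is used or hidden; nothing bears on infinite volume, a mass gap, or the Clay problem;
**NE3 is NOT proved** (leaf R2b part 1 of the kinematic lemma `SmoothRefine`; R1 and the assembly remain).  ABSOLUTE RULE
kept: no printed sentence is a hypothesis of any declaration; no `sorry`, no axioms beyond Mathlib's.  PLACEMENT (human
rule 2026-08-19): cell work under `Summits/QuantumFields/BalabanUV/`; imports the tree's `B8Lemma1NonAbelian` (for
`treeWord_zsmul_e`) only; moves nothing.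
-/

set_option autoImplicit false

open scoped BigOperators

namespace Summit.QuantumFields.BalabanUV.T4Continuum.ChainEndWords

noncomputable section

open Literature.MathematicalPhysics.QuantumFieldTheory.Balaban1983to89
open B7Prop1Explicit B7Prop2Explicit
open B8Lemma1NonAbelian (treeWord_zsmul_e zsmul_e_apply)

variable {d : ℕ}

/-! ## §1 Chain ends and the modified configuration -/

/-- The fine bond traversed by the letter `l` from `x`: `(x, μ)` for `+e_μ`, `(x − e_μ, μ)` for `−e_μ`
(`stepHol` reads exactly this bond variable). [folklore] -/
def letterBond (x : Site d) (l : Letter d) : Site d × Fin d := if l.2 then (x, l.1) else (x - e l.1, l.1)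

/-- `letterBond` of `+e_μ`. [folklore] -/
@[simp] theorem letterBond_true (x : Site d) (μ : Fin d) : letterBond x (μ, true) = (x, μ) := rfl
/-- `letterBond` of `−e_μ`. [folklore] -/
@[simp] theorem letterBond_false (x : Site d) (μ : Fin d) : letterBond x (μ, false) = (x - e μ, μ) := rfl

/-- The reversed letter from the far end traverses the same bond. [folklore] -/
theorem letterBond_rev (x : Site d) (l : Letter d) : letterBond (x + l.vec) l.rev = letterBond x l := by
  obtain ⟨μ, b⟩ := l
  cases b <;> simp [letterBond, Letter.rev, Letter.vec, sub_eq_add_neg]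

/-- **CHAIN END**: the fine bond `(y, μ)` is the last bond of the chain of a coarse bond iff `y + e_μ ∈ L·ℤ^d`
(then the coarse bond is `((y + e_μ)/L − e_μ, μ)`). [folklore] -/
def IsChainEnd (L : ℕ) (y : Site d) (μ : Fin d) : Prop := ∀ ν : Fin d, (L : ℤ) ∣ (y + e μ) ν

/-- `IsChainEnd` is decidable (finitely many divisibility conditions). [folklore] -/
instance (L : ℕ) (y : Site d) (μ : Fin d) : Decidable (IsChainEnd L y μ) := by
  unfold IsChainEnd; infer_instance

/-- The coarse bond whose chain ends at `(y, μ)`: `z = (y + e_μ)/L − e_μ`. [folklore] -/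
def chainIndex (L : ℕ) (y : Site d) (μ : Fin d) : Site d := fun ν => (y + e μ) ν / (L : ℤ) - e μ ν

/-- The chain end of the coarse bond `(z, κ)`: `Lz + (L−1)e_κ`. [folklore] -/
def chainEndSite (L : ℕ) (z : Site d) (κ : Fin d) : Site d := (L : ℤ) • z + ((L : ℤ) - 1) • e κ

/-- `Lz + (L−1)e_κ + e_κ = L(z + e_κ)`. [folklore] -/
theorem chainEndSite_add_e (L : ℕ) (z : Site d) (κ : Fin d) :
    chainEndSite L z κ + e κ = (L : ℤ) • (z + e κ) := by
  ext ν; simp [chainEndSite, e_apply]; split_ifs <;> ring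

/-- The chain end of `(z, κ)` is a chain end. [folklore] -/
theorem isChainEnd_chainEndSite (L : ℕ) (z : Site d) (κ : Fin d) : IsChainEnd L (chainEndSite L z κ) κ := by
  intro ν
  rw [chainEndSite_add_e]
  exact ⟨(z + e κ) ν, by simp⟩

/-- … and its coarse bond is `(z, κ)` (`L ≥ 1`). [folklore] -/
theorem chainIndex_chainEndSite (L : ℕ) (hL : 1 ≤ L) (z : Site d) (κ : Fin d) :
    chainIndex L (chainEndSite L z κ) κ = z := by
  have hL0 : (L : ℤ) ≠ 0 := by exact_mod_cast (by omega : L ≠ 0)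
  ext ν
  have h1 : (chainEndSite L z κ + e κ) ν = (L : ℤ) * (z + e κ) ν := by
    rw [chainEndSite_add_e]; simp
  simp only [chainIndex]
  rw [h1, Int.mul_ediv_cancel_left _ hL0]
  simp

section Modify

variable {G : Type*} [Group G]

/-- **THE CHAIN-END MODIFICATION**: multiply every chain end `(y, μ)` on the right by the coarse field `c` at its coarse
bond; all other bonds unchanged. [folklore] -/
def modify (L : ℕ) (W : Site d → Fin d → G) (c : Site d → Fin d → G) : Site d → Fin d → G :=
  fun y μ => if IsChainEnd L y μ then W y μ * c (chainIndex L y μ) μ else W y μ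

/-- Off the chain ends `modify` does nothing. [folklore] -/
theorem modify_of_not {L : ℕ} (W c : Site d → Fin d → G) {y : Site d} {μ : Fin d} (h : ¬ IsChainEnd L y μ) :
    modify L W c y μ = W y μ := by
  simp [modify, h]

/-- At the chain end of `(z, κ)`: `modify L W c = W · c z κ` (`L ≥ 1`). [folklore] -/
theorem modify_chainEndSite {L : ℕ} (hL : 1 ≤ L) (W c : Site d → Fin d → G) (z : Site d) (κ : Fin d) :
    modify L W c (chainEndSite L z κ) κ = W (chainEndSite L z κ) κ * c z κ := by
  simp [modify, isChainEnd_chainEndSite, chainIndex_chainEndSite L hL]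

/-- Values in a subgroup are preserved by `modify`. [folklore] -/
theorem modify_mem {L : ℕ} {S : Subgroup G} {W c : Site d → Fin d → G} (hW : ∀ y μ, W y μ ∈ S)
    (hc : ∀ z μ, c z μ ∈ S) (y : Site d) (μ : Fin d) : modify L W c y μ ∈ S := by
  unfold modify; split_ifs
  · exact S.mul_mem (hW y μ) (hc _ μ)
  · exact hW y μ

/-! ## §2 Words avoiding the chain ends -/

/-- The word `w` spelled from `x` traverses no chain end. [folklore] -/
def Avoids (L : ℕ) : Site d → List (Letter d) → Prop
  | _, [] => True
  | x, l :: w => ¬ IsChainEnd L (letterBond x l).1 (letterBond x l).2 ∧ Avoids L (x + l.vec) w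

/-- `Avoids` of the empty word. [folklore] -/
@[simp] theorem avoids_nil (L : ℕ) (x : Site d) : Avoids L x [] := trivial
/-- `Avoids` of a cons. [folklore] -/
theorem avoids_cons (L : ℕ) (x : Site d) (l : Letter d) (w : List (Letter d)) :
    Avoids L x (l :: w) ↔ ¬ IsChainEnd L (letterBond x l).1 (letterBond x l).2 ∧ Avoids L (x + l.vec) w := Iff.rfl

/-- `Avoids` of a concatenation. [folklore] -/
theorem avoids_append (L : ℕ) : ∀ (x : Site d) (w₁ w₂ : List (Letter d)),
    Avoids L x (w₁ ++ w₂) ↔ Avoids L x w₁ ∧ Avoids L (x + disp w₁) w₂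
  | x, [], w₂ => by simp
  | x, l :: w₁, w₂ => by
    rw [List.cons_append, avoids_cons, avoids_cons, avoids_append L (x + l.vec) w₁ w₂, disp_cons, add_assoc, and_assoc]

/-- `Avoids` of the reversed word (same bonds, traversed backwards). [folklore] -/
theorem avoids_revWord (L : ℕ) : ∀ (x : Site d) (w : List (Letter d)),
    Avoids L (x + disp w) (revWord w) ↔ Avoids L x w
  | x, [] => by simp
  | x, l :: w => by
    rw [revWord_cons, avoids_append, disp_cons, disp_revWord, avoids_cons,
      show x + (l.vec + disp w) = (x + l.vec) + disp w by abel, avoids_revWord L (x + l.vec) w,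
      show x + l.vec + disp w + -disp w = x + l.vec by abel, avoids_cons, letterBond_rev]
    simp only [avoids_nil, and_true]
    exact and_comm

/-- A letter that traverses no chain end reads the unmodified bond variable. [folklore] -/
theorem stepHol_modify_of_not {L : ℕ} (W c : Site d → Fin d → G) {x : Site d} {l : Letter d}
    (h : ¬ IsChainEnd L (letterBond x l).1 (letterBond x l).2) : stepHol (modify L W c) x l = stepHol W x l := by
  obtain ⟨μ, b⟩ := l
  cases b
  · simp only [letterBond_false] at h
    rw [stepHol_false, stepHol_false, modify_of_not W c h]
  · simp only [letterBond_true] at h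
    rw [stepHol_true, stepHol_true, modify_of_not W c h]

/-- **A word avoiding the chain ends has the same holonomy before and after the modification.** [folklore] -/
theorem hol_modify_of_avoids {L : ℕ} (W c : Site d → Fin d → G) : ∀ {x : Site d} {w : List (Letter d)},
    Avoids L x w → hol (modify L W c) x w = hol W x w
  | _, [], _ => by simp
  | x, l :: w, h => by
    rw [hol_cons, hol_cons, stepHol_modify_of_not W c h.1, hol_modify_of_avoids W c h.2]

/-! ## §3 The words of (42) from a block corner -/

/-- A forward segment in direction `κ` avoids the chain ends as long as `L ∤ x_κ + i + 1` along it. [folklore] -/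
theorem avoids_replicate_of (L : ℕ) (κ : Fin d) : ∀ (n : ℕ) (x : Site d),
    (∀ i : ℕ, i < n → ¬ (L : ℤ) ∣ x κ + (i + 1)) → Avoids L x (List.replicate n (κ, true))
  | 0, _, _ => by simp
  | n + 1, x, h => by
    rw [List.replicate_succ, avoids_cons, letterBond_true, Letter.vec_true]
    refine ⟨fun hce => h 0 (by omega) ?_, avoids_replicate_of L κ n (x + e κ) fun i hi => ?_⟩
    · have := hce κ
      simpa [e_apply] using this
    · have := h (i + 1) (by omega)
      simp only [Pi.add_apply, e_apply, if_true]
      push_cast at this ⊢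
      rwa [show x κ + 1 + ((i : ℤ) + 1) = x κ + ((i : ℤ) + 1 + 1) by ring]

/-- No multiple of `L` lies strictly between `Lq` and `Lq + L`: if `L ∣ a` and `1 ≤ j < L` then `L ∤ a + j`. [folklore] -/
theorem not_dvd_add_of_dvd {L : ℕ} {a j : ℤ} (ha : (L : ℤ) ∣ a) (hj1 : 1 ≤ j) (hjL : j < L) : ¬ (L : ℤ) ∣ a + j := by
  intro h
  have hj : (L : ℤ) ∣ j := by simpa using (Int.dvd_add_right ha).mp h
  exact absurd (Int.le_of_dvd (by omega) hj) (by omega)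

/-- A forward segment of `n ≤ L − 1` steps in direction `κ` from a point with `L ∣ x_κ` avoids the chain ends (its bonds
sit at in-block positions `0, …, n−1 ≤ L−2`). [folklore] -/
theorem avoids_seg_of_dvd (L : ℕ) (κ : Fin d) {n : ℕ} (hn : n < L) {x : Site d} (hx : (L : ℤ) ∣ x κ) :
    Avoids L x (seg κ (n : ℤ)) := by
  rw [seg_natCast]
  exact avoids_replicate_of L κ n x fun i hi => not_dvd_add_of_dvd hx (by omega) (by omega)

/-- A forward segment in direction `κ` from a point with `L ∤ x_ν` for some `ν ≠ κ` avoids the chain ends, whatever its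
length (its bonds keep the transverse coordinate `x_ν`). [folklore] -/
theorem avoids_replicate_of_transverse (L : ℕ) {κ ν : Fin d} (hνκ : ν ≠ κ) : ∀ (n : ℕ) (x : Site d),
    ¬ (L : ℤ) ∣ x ν → Avoids L x (List.replicate n (κ, true))
  | 0, _, _ => by simp
  | n + 1, x, h => by
    rw [List.replicate_succ, avoids_cons, letterBond_true, Letter.vec_true]
    have hν : (x + e κ) ν = x ν := by simp [e_apply, hνκ]
    refine ⟨fun hce => h ?_, avoids_replicate_of_transverse L hνκ n (x + e κ) (by rwa [hν])⟩
    have := hce ν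
    rwa [hν] at this

/-- **The tree words of (42) from a block corner avoid the chain ends** — general form: a concatenation of forward
segments `seg κ (v κ)`, `0 ≤ v κ < L`, over a duplicate-free list of directions, from a point whose listed coordinates
are multiples of `L`. [folklore] -/
theorem avoids_flatMap_seg (L : ℕ) (v : Site d) (hv : ∀ κ, 0 ≤ v κ ∧ v κ < L) :
    ∀ (ks : List (Fin d)), ks.Nodup → ∀ (x : Site d), (∀ κ ∈ ks, (L : ℤ) ∣ x κ) →
      Avoids L x (ks.flatMap fun κ => seg κ (v κ))
  | [], _, x, _ => by simp
  | κ :: ks, hnd, x, hx => by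
    rw [List.flatMap_cons, avoids_append, disp_seg]
    have hκ := List.nodup_cons.mp hnd
    obtain ⟨n, hn⟩ := Int.eq_ofNat_of_zero_le (hv κ).1
    have hnL : n < L := by have := (hv κ).2; omega
    refine ⟨?_, avoids_flatMap_seg L v hv ks hκ.2 (x + v κ • e κ) fun κ' hκ' => ?_⟩
    · rw [hn]; exact avoids_seg_of_dvd L κ hnL (hx κ (by simp))
    · have hne : κ' ≠ κ := fun h => hκ.1 (h ▸ hκ')
      have : (x + v κ • e κ) κ' = x κ' := by simp [e_apply, hne]
      rw [this]; exact hx κ' (by simp [hκ'])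

/-- The offsets `boxVec L r`, `r : Fin d → Fin L`, have coordinates in `[0, L)`. [folklore] -/
theorem boxVec_bounds (L : ℕ) (r : Fin d → Fin L) (κ : Fin d) : 0 ≤ boxVec L r κ ∧ boxVec L r κ < L := by
  simp only [boxVec]; exact ⟨by positivity, by exact_mod_cast (r κ).isLt⟩

/-- **`Γ_{y,x}` from the corner `y = L·z` to `x = L·z + r` avoids every chain end.** [folklore] -/
theorem avoids_treeWord_corner (L : ℕ) (z : Site d) (r : Fin d → Fin L) :
    Avoids L ((L : ℤ) • z) (treeWord (boxVec L r)) :=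
  avoids_flatMap_seg L (boxVec L r) (boxVec_bounds L r) _ (List.nodup_reverse.mpr (List.nodup_finRange d)) _
    fun κ _ => ⟨z κ, by simp⟩

/-- **An OFF-LINE line of (42) avoids every chain end**: the `L`-segment in direction `κ` from `L·z + r` with
`r_ν ≠ 0` for some `ν ≠ κ`. [folklore] -/
theorem avoids_line_offline (L : ℕ) (z : Site d) {κ ν : Fin d} (hνκ : ν ≠ κ) (r : Fin d → Fin L)
    (hr : (r ν : ℕ) ≠ 0) (n : ℕ) : Avoids L ((L : ℤ) • z + boxVec L r) (seg κ (n : ℤ)) := by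
  rw [seg_natCast]
  refine avoids_replicate_of_transverse L hνκ n _ ?_
  have hlt : (r ν : ℕ) < L := (r ν).isLt
  have : ((L : ℤ) • z + boxVec L r) ν = (L : ℤ) * z ν + (r ν : ℕ) := by simp [boxVec]
  rw [this]
  exact not_dvd_add_of_dvd ⟨z ν, rfl⟩ (by omega) (by omega)

/-- **The chain meets exactly its own end**: `hol (modify L W c) (L·z) (seg κ L) = hol W (L·z) (seg κ L) · c z κ`
(`L ≥ 1`). [folklore] -/
theorem hol_modify_chain {L : ℕ} (hL : 1 ≤ L) (W c : Site d → Fin d → G) (z : Site d) (κ : Fin d) :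
    hol (modify L W c) ((L : ℤ) • z) (seg κ (L : ℤ)) = hol W ((L : ℤ) • z) (seg κ (L : ℤ)) * c z κ := by
  obtain ⟨m, rfl⟩ : ∃ m : ℕ, L = m + 1 := ⟨L - 1, by omega⟩
  have hseg : seg κ (((m + 1 : ℕ) : ℤ)) = seg κ ((m : ℤ) + 1) := by push_cast; rfl
  rw [hseg, hol_seg_succ, hol_seg_succ]
  have havoid : Avoids (m + 1) (((m + 1 : ℕ) : ℤ) • z) (seg κ (m : ℤ)) :=
    avoids_seg_of_dvd (m + 1) κ (by omega) ⟨z κ, by simp⟩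
  have hend : ((m + 1 : ℕ) : ℤ) • z + (m : ℤ) • e κ = chainEndSite (m + 1) z κ := by
    simp only [chainEndSite]; push_cast; module
  rw [hol_modify_of_avoids W c havoid, hend, modify_chainEndSite (by omega), mul_assoc]

/-! ## §4 The loop variables `Wcx` of (42): on-line degenerate, off-line twisted -/

/-- An on-line offset is a multiple of `e_κ`: `boxVec L r = r_κ • e_κ` when `r_ν = 0` for `ν ≠ κ`. [folklore] -/
theorem boxVec_online (L : ℕ) {κ : Fin d} (r : Fin d → Fin L) (hon : ∀ ν, ν ≠ κ → (r ν : ℕ) = 0) :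
    boxVec L r = ((r κ : ℕ) : ℤ) • e κ := by
  ext ν
  rw [zsmul_e_apply]
  simp only [boxVec]
  split_ifs with h
  · rw [h]
  · simp [hon ν h]

/-- Forward segments compose additively. [folklore] -/
theorem seg_natCast_add (κ : Fin d) (a b : ℕ) : seg κ (((a + b : ℕ) : ℤ)) = seg κ (a : ℤ) ++ seg κ (b : ℤ) := by
  rw [seg_natCast, seg_natCast, seg_natCast, List.replicate_add]

/-- The full contour `Γ_{c,x}` of (42) from the corner `L·z` to an OFF-LINE `x` avoids every chain end. [folklore] -/
theorem avoids_gammaWord_offline (L : ℕ) (z : Site d) {κ ν : Fin d} (hνκ : ν ≠ κ) (r : Fin d → Fin L)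
    (hr : (r ν : ℕ) ≠ 0) : Avoids L ((L : ℤ) • z) (gammaWord L κ (boxVec L r)) := by
  rw [gammaWord, avoids_append, avoids_append, disp_append, disp_treeWord, disp_seg]
  refine ⟨⟨avoids_treeWord_corner L z r, avoids_line_offline L z hνκ r hr L⟩, ?_⟩
  have hpt : (L : ℤ) • z + (boxVec L r + (L : ℤ) • e κ) = (L : ℤ) • (z + e κ) + disp (treeWord (boxVec L r)) := by
    rw [disp_treeWord, smul_add]; abel
  rw [hpt, avoids_revWord]
  exact avoids_treeWord_corner L (z + e κ) r

section Loops

variable {𝔸 : Type*} [NormedRing 𝔸]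

/-- **ON-LINE LOOPS ARE DEGENERATE** — for EVERY configuration: `V(Γ_{c,x})V(c)⁻¹ = 1` when `x = c₋ + n e_κ` lies on
the line of `c` (the contour (14) runs out along the line and straight back). [folklore] -/
theorem Wcx_online_eq_one (L : ℕ) (V : Site d → Fin d → 𝔸ˣ) (y : Site d) (κ : Fin d) (n : ℕ) :
    Wcx L V y κ ((n : ℤ) • e κ) = 1 := by
  rw [Wcx, gammaWord, treeWord_zsmul_e, revWord_seg, hol_append, hol_append, disp_append, disp_seg, disp_seg]
  -- the return leg: `hol (y + (n+L)e_κ) (seg κ (−n)) = (hol (y + L e_κ) (seg κ n))⁻¹`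
  have hback : hol V (y + ((n : ℤ) • e κ + (L : ℤ) • e κ)) (seg κ (-(n : ℤ)))
      = (hol V (y + (L : ℤ) • e κ) (seg κ (n : ℤ)))⁻¹ := by
    rw [← revWord_seg]
    exact hol_revWord' V (x := y + (L : ℤ) • e κ) _ (seg κ (n : ℤ)) (by rw [disp_seg]; abel)
  -- both ways along the line spell `seg κ (n + L)`
  have h1 : hol V y (seg κ (n : ℤ)) * hol V (y + (n : ℤ) • e κ) (seg κ (L : ℤ)) = hol V y (seg κ ((n + L : ℕ) : ℤ)) := by
    rw [seg_natCast_add, hol_append, disp_seg]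
  have h2 : hol V y (seg κ (L : ℤ)) * hol V (y + (L : ℤ) • e κ) (seg κ (n : ℤ)) = hol V y (seg κ ((n + L : ℕ) : ℤ)) := by
    rw [Nat.add_comm, seg_natCast_add, hol_append, disp_seg]
  rw [hback, h1, ← h2]
  group

/-- On-line, in the `boxVec` parametrisation of (42). [folklore] -/
theorem Wcx_online (L : ℕ) (V : Site d → Fin d → 𝔸ˣ) (y : Site d) {κ : Fin d} (r : Fin d → Fin L)
    (hon : ∀ ν, ν ≠ κ → (r ν : ℕ) = 0) : Wcx L V y κ (boxVec L r) = 1 := by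
  rw [boxVec_online L r hon]; exact Wcx_online_eq_one L V y κ _

/-- The chain product `S = W(Γ_c)` of the coarse bond `(z, κ)` (the straight contour of (42) from `L·z`). [folklore] -/
def chainProd (L : ℕ) (W : Site d → Fin d → 𝔸ˣ) (z : Site d) (κ : Fin d) : 𝔸ˣ :=
  hol W ((L : ℤ) • z) (seg κ (L : ℤ))

/-- **THE TWISTED LOOP VARIABLE** `Wcx_r[W] · (S (c z κ)⁻¹ S⁻¹)` of the off-line offset `r`. [folklore] -/
def twistedWcx (L : ℕ) (W c : Site d → Fin d → 𝔸ˣ) (z : Site d) (κ : Fin d) (r : Fin d → Fin L) : 𝔸ˣ :=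
  Wcx L W ((L : ℤ) • z) κ (boxVec L r) * (chainProd L W z κ * (c z κ)⁻¹ * (chainProd L W z κ)⁻¹)

/-- **OFF-LINE LOOPS OF THE MODIFIED CONFIGURATION ARE THE OLD ONES TWISTED BY `Ad_S(c⁻¹)`**:
`Wcx L (modify L W c) (L·z) κ r = Wcx L W (L·z) κ r · (S · (c z κ)⁻¹ · S⁻¹)`, `S = W(Γ_c)` the chain product, for
every off-line `r` (`L ≥ 1`). [folklore] -/
theorem Wcx_modify_offline {L : ℕ} (hL : 1 ≤ L) (W c : Site d → Fin d → 𝔸ˣ) (z : Site d) {κ ν : Fin d}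
    (hνκ : ν ≠ κ) (r : Fin d → Fin L) (hr : (r ν : ℕ) ≠ 0) :
    Wcx L (modify L W c) ((L : ℤ) • z) κ (boxVec L r) = twistedWcx L W c z κ r := by
  rw [twistedWcx, chainProd, Wcx, Wcx, hol_modify_of_avoids W c (avoids_gammaWord_offline L z hνκ r hr),
    hol_modify_chain hL]
  group

end Loops

/-! ## §5 The exponent and the average of the modified configuration at one coarse bond -/

/-- The off-line offsets of the block (those `r ∈ [0,L)^d` off the line of `c`). [folklore] -/
def offLine (d L : ℕ) (κ : Fin d) : Finset (Fin d → Fin L) :=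
  Finset.univ.filter fun r => ∃ ν, ν ≠ κ ∧ (r ν : ℕ) ≠ 0

/-- Membership in `offLine`. [folklore] -/
theorem mem_offLine {L : ℕ} {κ : Fin d} {r : Fin d → Fin L} :
    r ∈ offLine d L κ ↔ ∃ ν, ν ≠ κ ∧ (r ν : ℕ) ≠ 0 := by
  simp [offLine]

/-- Off `offLine` every transverse coordinate vanishes. [folklore] -/
theorem online_of_not_mem {L : ℕ} {κ : Fin d} {r : Fin d → Fin L} (h : r ∉ offLine d L κ) :
    ∀ ν, ν ≠ κ → (r ν : ℕ) = 0 := by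
  intro ν hν
  by_contra hne
  exact h (mem_offLine.mpr ⟨ν, hν, hne⟩)

section Average

variable {𝔸 : Type*} [NormedRing 𝔸] [NormedAlgebra ℂ 𝔸] [CompleteSpace 𝔸]

/-- **THE OFF-LINE EXPONENT** `Σ_{r off-line} L^{−d} log (Wcx_r[W] · S (c z κ)⁻¹ S⁻¹)`. [folklore] -/
def offLineX (L : ℕ) (W c : Site d → Fin d → 𝔸ˣ) (z : Site d) (κ : Fin d) : 𝔸 :=
  ∑ r ∈ offLine d L κ, (((L : ℝ) ^ d)⁻¹) • MatrixLog.mlog ((twistedWcx L W c z κ r : 𝔸ˣ) : 𝔸)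

omit [CompleteSpace 𝔸] in
/-- **THE EXPONENT OF (42) FOR THE MODIFIED CONFIGURATION** at the coarse bond `(z, κ)` is the off-line exponent:
the on-line terms vanish (`log 1 = 0`) and the off-line loop variables are twisted by `Ad_S((c z κ)⁻¹)`. [folklore] -/
theorem Xavg_modify {L : ℕ} (hL : 1 ≤ L) (W c : Site d → Fin d → 𝔸ˣ) (z : Site d) (κ : Fin d) :
    Xavg L (modify L W c) ((L : ℤ) • z) κ = offLineX L W c z κ := by
  unfold Xavg offLineX offLine
  rw [← Finset.sum_filter_add_sum_filter_not Finset.univ (fun r : Fin d → Fin L => ∃ ν, ν ≠ κ ∧ (r ν : ℕ) ≠ 0)]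
  have hon : ∀ r ∈ Finset.univ.filter (fun r : Fin d → Fin L => ¬ ∃ ν, ν ≠ κ ∧ (r ν : ℕ) ≠ 0),
      (((L : ℝ) ^ d)⁻¹) • MatrixLog.mlog ((Wcx L (modify L W c) ((L : ℤ) • z) κ (boxVec L r) : 𝔸ˣ) : 𝔸) = 0 := by
    intro r hr
    have hr' : r ∉ offLine d L κ := by
      rw [mem_offLine]; exact (Finset.mem_filter.mp hr).2
    rw [Wcx_online L _ _ r (online_of_not_mem hr'), Units.val_one, MatrixLog.mlog_one, smul_zero]
  rw [Finset.sum_congr rfl hon, Finset.sum_const_zero, add_zero]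
  refine Finset.sum_congr rfl fun r hr => ?_
  obtain ⟨ν, hνκ, hrν⟩ := (mem_offLine (d := d)).mp hr
  rw [Wcx_modify_offline hL W c z hνκ r hrν]

/-- **THE AVERAGE (42) OF THE MODIFIED CONFIGURATION** at the coarse bond `(z, κ)`:
`\overline{modify L W c}(c) = exp(offLineX) · W(Γ_c) · c z κ` — it depends on the correction field `c` only through
`c z κ`. [folklore] -/
theorem bavg_modify {L : ℕ} (hL : 1 ≤ L) (W c : Site d → Fin d → 𝔸ˣ) (z : Site d) (κ : Fin d) :
    bavg L (modify L W c) ((L : ℤ) • z) κ = expUnit (offLineX L W c z κ) * (chainProd L W z κ * c z κ) := by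
  rw [bavg, Xavg_modify hL, chainProd, hol_modify_chain hL]

/-- **… and read on the next lattice**: `rescale L (bavg L (modify L W c)) z κ = exp(offLineX) · S · c z κ`. [folklore] -/
theorem rescale_bavg_modify {L : ℕ} (hL : 1 ≤ L) (W c : Site d → Fin d → 𝔸ˣ) (z : Site d) (κ : Fin d) :
    rescale L (bavg L (modify L W c)) z κ = expUnit (offLineX L W c z κ) * (chainProd L W z κ * c z κ) := by
  rw [rescale_apply, bavg_modify hL]

end Average

end Modify

end

end Summit.QuantumFields.BalabanUV.T4Continuum.ChainEndWords
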